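import Summits.KontsevichZagierPeriods.Zeta5Search.LaiSweepShard

/-!
# `κ₃` sweep certificate — shard file 086 of 127 (shards 602–608 of 889)

HONEST FRAMING. Systematic search; no irrationality claim unless certified. This file only checks,
by `decide +kernel`, shards 602–608 of the order-cell sweep of the `κ₃` point `(74, 2180, 444; δ74)`
(engine `LaiSweepEngine`, soundness `LaiSweepJump/Free/Eval/Shard/Kappa3`; a shard is `⟨regime, n,
p, q, p', q', Lo, Up⟩`: `n` cells from `p/q` to `p'/q'` with integer rate sums in `[Lo, Up]`, `K =
128`, `D = 2^40`). It draws NO conclusion: only the capstone `LaiKappa3SweepCert`, which needs all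
127 shard files, does. Kernel cost of this file ≈ 560 cells × 0.3 s.
-/

namespace Summit.KontsevichZagierPeriods.Zeta5Search.Sweep

set_option maxHeartbeats 100000000 in
/-- Shard 602: 80 cells of regime B from `218/341` to `180/281`.
[cite: Lai2024BallRivoal, §4 Lemma 4.3] -/
theorem shard602 :
    Shard.check 128 (2^40)
      ⟨true, 80, 218, 341, 180, 281, 12892958648414, 17539207180991⟩ = true := by
  decide +kernel

set_option maxHeartbeats 100000000 in
/-- Shard 603: 80 cells of regime B from `180/281` to `138/215`.
[cite: Lai2024BallRivoal, §4 Lemma 4.3] -/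
theorem shard603 :
    Shard.check 128 (2^40)
      ⟨true, 80, 180, 281, 138, 215, 13061935293122, 17787744120464⟩ = true := by
  decide +kernel

set_option maxHeartbeats 100000000 in
/-- Shard 604: 80 cells of regime B from `138/215` to `155/241`.
[cite: Lai2024BallRivoal, §4 Lemma 4.3] -/
theorem shard604 :
    Shard.check 128 (2^40)
      ⟨true, 80, 138, 215, 155, 241, 13055486729513, 17798093004791⟩ = true := by
  decide +kernel

set_option maxHeartbeats 100000000 in
/-- Shard 605: 80 cells of regime B from `155/241` to `212/329`.
[cite: Lai2024BallRivoal, §4 Lemma 4.3] -/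
theorem shard605 :
    Shard.check 128 (2^40)
      ⟨true, 80, 155, 241, 212, 329, 12340864883196, 16840986102975⟩ = true := by
  decide +kernel

set_option maxHeartbeats 100000000 in
/-- Shard 606: 80 cells of regime B from `212/329` to `82/127`.
[cite: Lai2024BallRivoal, §4 Lemma 4.3] -/
theorem shard606 :
    Shard.check 128 (2^40)
      ⟨true, 80, 212, 329, 82, 127, 13015801197138, 17780537035146⟩ = true := by
  decide +kernel

set_option maxHeartbeats 100000000 in
/-- Shard 607: 80 cells of regime B from `82/127` to `185/286`.
[cite: Lai2024BallRivoal, §4 Lemma 4.3] -/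
theorem shard607 :
    Shard.check 128 (2^40)
      ⟨true, 80, 82, 127, 185, 286, 11913974124490, 16291871188179⟩ = true := by
  decide +kernel

set_option maxHeartbeats 100000000 in
/-- Shard 608: 80 cells of regime B from `185/286` to `35/54`.
[cite: Lai2024BallRivoal, §4 Lemma 4.3] -/
theorem shard608 :
    Shard.check 128 (2^40)
      ⟨true, 80, 185, 286, 35, 54, 13016237252265, 17817537780800⟩ = true := by
  decide +kernel

/-- The checked shards of this file, in order. [folklore] -/
def shards086 : List (CheckedShard 128 (2^40)) :=
  [⟨_, shard602⟩, ⟨_, shard603⟩, ⟨_, shard604⟩, ⟨_, shard605⟩, ⟨_, shard606⟩,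
    ⟨_, shard607⟩, ⟨_, shard608⟩]

end Summit.KontsevichZagierPeriods.Zeta5Search.Sweep
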